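import Literature.NumberTheory.Transcendental.PkappaTheta
import Literature.NumberTheory.Transcendental.SigmaJets
import Literature.NumberTheory.Transcendental.UnivExtThetaAddition
import HarnessLib

/-!
# One point of `Lie M_κ` where `n` theta ratios have injective differential

Topic `Literature/NumberTheory/Transcendental`. A brick for the theta-model instance of the
abstract zero estimate (`ZeroEstModel.lean`, field `nondeg`): at the point `w₀ = (0, z₀, 0)`
(`z₀ ∉ Λ`, `℘′(z₀) ≠ 0`, on every `E`-coordinate) and in the chart `J₀ = (none, (0, none))`
(`Θ_{J₀} = ∏_b σ(z'_b)³`), the `n = |β| + |γ| + |δ|` coordinate ratios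
`e^{y'_j}`, `℘(z'_b)`, `s_e - ∑_b κ_{eb} ζ(z'_b)` (`Θ_{(some j,(0,none))}/Θ_{J₀}`,
`Θ_{(none,(0[b↦1],none))}/Θ_{J₀}`, `Θ_{(none,(0,some e))}/Θ_{J₀}`) have injective differential:
their derivatives at `t = 0` along `w₀ + t x` are `x_{y,j}`, `℘′(z₀) x_{z,b}`,
`x_{s,e} + ∑_b κ_{eb} ℘(z₀) x_{z,b}`. PROVED: `exists_nondeg_point`.

## References

* Yu. V. Nesterenko, P. Philippon (eds.), *Introduction to Algebraic Independence Theory*,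
  LNM 1752, Springer 2001, Ch. 11 §2.2 (i) (`dim G`). [NesterenkoPhilippon2001]
-/

noncomputable section

open Complex Filter Topology
open scoped PeriodPair

namespace Literature.NumberTheory.Transcendental

namespace GaGmE

namespace Std

variable {β γ δ : Type} [Fintype β] [Fintype γ] [Fintype δ] [DecidableEq γ]
variable (L : PeriodPair) (κM : δ → γ → Kbar)

/-! ### A point off the lattice where `℘′ ≠ 0` -/

/-- **Some `z₀ ∉ Λ` has `℘′(z₀) ≠ 0`** (near `0`, `σ³℘′ → -2`). [folklore] -/
theorem _root_.PeriodPair.exists_derivWeierstrassP_ne_zero : ∃ z : ℂ, z ∉ L.lattice ∧ ℘'[L] z ≠ 0 := by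
  have hc : ContinuousAt (L.univExtP 2) 0 := (L.differentiable_univExtP 2).continuous.continuousAt
  have h0 : L.univExtP 2 0 ≠ 0 := by rw [L.univExtP_at_zero.2.2]; norm_num
  have hopen : IsOpen {z : ℂ | L.univExtP 2 z ≠ 0} :=
    isOpen_ne.preimage (L.differentiable_univExtP 2).continuous
  obtain ⟨z, hz1, hz2⟩ := L.dense_compl_lattice.inter_open_nonempty _ hopen ⟨0, h0⟩
  refine ⟨z, hz2, fun h => hz1 ?_⟩
  show L.univExtP 2 z = 0
  rw [(PeriodPair.univExtP_eq hz2).2.2, h, mul_zero]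

/-! ### The point, the chart and the ratios -/

/-- The point `w₀ = (0, z₀, 0)`. [folklore] -/
def ndPoint (z₀ : ℂ) : β ⊕ (γ ⊕ δ) → ℂ := fun k =>
  match k with
  | Sum.inr (Sum.inl _) => z₀
  | _ => 0

omit [Fintype β] [Fintype γ] [Fintype δ] [DecidableEq γ] in
/-- `y`-coordinates of `w₀`. [folklore] -/
@[simp] theorem ndPoint_iy (z₀ : ℂ) (j : β) : ndPoint (γ := γ) (δ := δ) z₀ (iy j) = 0 := rfl
omit [Fintype β] [Fintype γ] [Fintype δ] [DecidableEq γ] in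
/-- `z`-coordinates of `w₀`. [folklore] -/
@[simp] theorem ndPoint_iz (z₀ : ℂ) (b : γ) : ndPoint (β := β) (δ := δ) z₀ (iz b) = z₀ := rfl
omit [Fintype β] [Fintype γ] [Fintype δ] [DecidableEq γ] in
/-- `s`-coordinates of `w₀`. [folklore] -/
@[simp] theorem ndPoint_is (z₀ : ℂ) (e : δ) : ndPoint (β := β) (γ := γ) z₀ (is e) = 0 := rfl

/-- The ratio indices: `iy j ↦ (some j, (0, none))`, `iz b ↦ (none, (0[b ↦ 1], none))`,
`is e ↦ (none, (0, some e))`. [folklore] -/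
def ndIdx : β ⊕ (γ ⊕ δ) → Option β × ThetaIdx γ δ
  | Sum.inl j => (some j, (fun _ => 0, none))
  | Sum.inr (Sum.inl b) => (none, (Function.update (fun _ => 0) b 1, none))
  | Sum.inr (Sum.inr e) => (none, (fun _ => 0, some e))

/-- The chart `J₀ = (none, (0, none))`. [folklore] -/
def ndChart : Option β × ThetaIdx γ δ := (none, (fun _ => 0, none))

omit [Fintype β] [Fintype δ] in
/-- `Θ_{J₀}(w) = ∏_b σ(z'_b)³` off the divisors. [folklore] -/
theorem theta_ndChart {w : β ⊕ (γ ⊕ δ) → ℂ} (hw : ∀ b, w (iz b) ∉ L.lattice) :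
    theta L κM (ndChart (β := β)) w = ∏ b, L.weierstrassSigma (w (iz b)) ^ 3 := by
  simp only [ndChart, theta, thetaT_none, thetaP_none, one_mul, thetaPnone_eq L _ hw]
  simp

omit [Fintype β] [Fintype δ] in
/-- `Θ_{(some j,(0,none))}(w) = e^{y'_j} ∏_b σ³`. [folklore] -/
theorem theta_ndIdx_iy {w : β ⊕ (γ ⊕ δ) → ℂ} (hw : ∀ b, w (iz b) ∉ L.lattice) (j : β) :
    theta L κM (ndIdx (Sum.inl j) : Option β × ThetaIdx γ δ) w =
      cexp (w (iy j)) * ∏ b, L.weierstrassSigma (w (iz b)) ^ 3 := by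
  simp only [ndIdx, theta, thetaT_some, thetaP_none, thetaPnone_eq L _ hw]
  simp

omit [Fintype β] [Fintype δ] in
/-- `Θ_{(none,(0[b↦1],none))}(w) = ℘(z'_b) ∏ σ³`. [folklore] -/
theorem theta_ndIdx_iz {w : β ⊕ (γ ⊕ δ) → ℂ} (hw : ∀ b, w (iz b) ∉ L.lattice) (b : γ) :
    theta L κM (ndIdx (β := β) (Sum.inr (Sum.inl b)) : Option β × ThetaIdx γ δ) w =
      ℘[L] (w (iz b)) * ∏ b', L.weierstrassSigma (w (iz b')) ^ 3 := by
  classical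
  simp only [ndIdx, theta, thetaT_none, thetaP_none, one_mul, thetaPnone_eq L _ hw]
  rw [mul_comm]
  congr 1
  rw [← Finset.mul_prod_erase Finset.univ _ (Finset.mem_univ b)]
  rw [Function.update_self]
  have : ∏ x ∈ Finset.univ.erase b, ![1, ℘[L] (w (iz x)), ℘'[L] (w (iz x))] (Function.update (fun _ => (0 : Fin 3)) b 1 x) = 1 := by
    refine Finset.prod_eq_one fun x hx => ?_
    rw [Function.update_of_ne (Finset.ne_of_mem_erase hx)]
    simp
  rw [this, mul_one]
  simp

omit [Fintype β] [Fintype δ] in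
/-- `Θ_{(none,(0,some e))}(w) = (s_e - ∑_b κ_{eb} ζ(z'_b)) ∏ σ³`. [folklore] -/
theorem theta_ndIdx_is {w : β ⊕ (γ ⊕ δ) → ℂ} (hw : ∀ b, w (iz b) ∉ L.lattice) (e : δ) :
    theta L κM (ndIdx (β := β) (Sum.inr (Sum.inr e)) : Option β × ThetaIdx γ δ) w =
      (w (is e) - ∑ b, (κM e b : ℂ) * L.weierstrassZeta (w (iz b))) * ∏ b', L.weierstrassSigma (w (iz b')) ^ 3 := by
  simp only [ndIdx, theta, thetaT_none, thetaP_some, one_mul, thetaPsome_eq L κM _ e hw]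
  simp only [Matrix.cons_val_zero, Finset.prod_const_one, mul_one]
  ring

/-! ### The differential of the ratios -/

omit [Fintype β] [Fintype δ] in
/-- **The derivatives of the `n` ratios at `w₀` along `x`.** [folklore] -/
theorem deriv_ratio_ndIdx {z₀ : ℂ} (hz₀ : z₀ ∉ L.lattice) (x : β ⊕ (γ ⊕ δ) → ℂ) (k : β ⊕ (γ ⊕ δ)) :
    deriv (fun t : ℂ => theta L κM (ndIdx k) (ndPoint (β := β) (δ := δ) z₀ + t • x) / theta L κM (ndChart (β := β)) (ndPoint (β := β) (δ := δ) z₀ + t • x)) 0 =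
      match k with
      | Sum.inl j => x (iy j)
      | Sum.inr (Sum.inl b) => ℘'[L] z₀ * x (iz b)
      | Sum.inr (Sum.inr e) => x (is e) + ∑ b, (κM e b : ℂ) * (℘[L] z₀ * x (iz b)) := by
  -- near `t = 0` all `E`-coordinates stay off the lattice
  have hnear : ∀ᶠ t : ℂ in 𝓝 0, ∀ b, ((ndPoint (β := β) (δ := δ) z₀ + t • x : β ⊕ (γ ⊕ δ) → ℂ) (iz b)) ∉ L.lattice := by
    have : ∀ b, ∀ᶠ t : ℂ in 𝓝 0, ((ndPoint (β := β) (δ := δ) z₀ + t • x : β ⊕ (γ ⊕ δ) → ℂ) (iz b)) ∉ L.lattice := by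
      intro b
      have hc : Continuous fun t : ℂ => ((ndPoint (β := β) (δ := δ) z₀ + t • x : β ⊕ (γ ⊕ δ) → ℂ) (iz b)) := by
        simp only [Pi.add_apply, Pi.smul_apply, smul_eq_mul, ndPoint_iz]; fun_prop
      exact hc.continuousAt.eventually_mem (L.isClosed_lattice.isOpen_compl.mem_nhds (by simpa using hz₀))
    exact Filter.eventually_all.mpr this
  have hσ : ∀ t : ℂ, (∀ b, ((ndPoint (β := β) (δ := δ) z₀ + t • x : β ⊕ (γ ⊕ δ) → ℂ) (iz b)) ∉ L.lattice) →
      ∏ b, L.weierstrassSigma (((ndPoint (β := β) (δ := δ) z₀ + t • x : β ⊕ (γ ⊕ δ) → ℂ) (iz b))) ^ 3 ≠ 0 := fun t ht =>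
    Finset.prod_ne_zero_iff.mpr fun b _ => pow_ne_zero _ (L.weierstrassSigma_ne_zero (ht b))
  rcases k with j | b | e
  · -- `e^{t x_j}`
    have heq : (fun t : ℂ => theta L κM (ndIdx (Sum.inl j)) (ndPoint (β := β) (δ := δ) z₀ + t • x) /
        theta L κM (ndChart (β := β)) (ndPoint (β := β) (δ := δ) z₀ + t • x)) =ᶠ[𝓝 0] fun t => cexp (t * x (iy j)) := by
      filter_upwards [hnear] with t ht
      rw [theta_ndIdx_iy L κM ht, theta_ndChart L κM ht, mul_div_assoc, div_self (hσ t ht), mul_one]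
      simp
    rw [heq.deriv_eq]
    have h : HasDerivAt (fun t : ℂ => cexp (t * x (iy j))) (cexp (0 * x (iy j)) * (1 * x (iy j))) 0 :=
      ((hasDerivAt_id (0 : ℂ)).mul_const _).cexp
    rw [h.deriv]; simp
  · -- `℘(z₀ + t x_b)`
    have heq : (fun t : ℂ => theta L κM (ndIdx (β := β) (Sum.inr (Sum.inl b))) (ndPoint (β := β) (δ := δ) z₀ + t • x) /
        theta L κM (ndChart (β := β)) (ndPoint (β := β) (δ := δ) z₀ + t • x)) =ᶠ[𝓝 0] fun t => ℘[L] (z₀ + t * x (iz b)) := by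
      filter_upwards [hnear] with t ht
      rw [theta_ndIdx_iz L κM ht, theta_ndChart L κM ht, mul_div_assoc, div_self (hσ t ht), mul_one]
      simp
    rw [heq.deriv_eq]
    have h℘ : HasDerivAt ℘[L] (℘'[L] z₀) z₀ := by
      have hd : DifferentiableAt ℂ ℘[L] z₀ :=
        L.differentiableOn_weierstrassP.differentiableAt (L.isClosed_lattice.isOpen_compl.mem_nhds hz₀)
      simpa using hd.hasDerivAt
    have hlin : HasDerivAt (fun t : ℂ => z₀ + t * x (iz b)) (x (iz b)) 0 := by
      simpa using ((hasDerivAt_id (0 : ℂ)).mul_const (x (iz b))).const_add z₀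
    have h℘' : HasDerivAt ℘[L] (℘'[L] z₀) (z₀ + 0 * x (iz b)) := by simpa using h℘
    have h : HasDerivAt (fun t : ℂ => ℘[L] (z₀ + t * x (iz b))) (℘'[L] z₀ * x (iz b)) 0 := by
      have := h℘'.comp 0 hlin; simpa [Function.comp_def] using this
    rw [h.deriv]
  · -- `t x_e - ∑ κ ζ(z₀ + t x_b)`
    have heq : (fun t : ℂ => theta L κM (ndIdx (β := β) (Sum.inr (Sum.inr e))) (ndPoint (β := β) (δ := δ) z₀ + t • x) /
        theta L κM (ndChart (β := β)) (ndPoint (β := β) (δ := δ) z₀ + t • x)) =ᶠ[𝓝 0]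
        fun t => t * x (is e) - ∑ b, (κM e b : ℂ) * L.weierstrassZeta (z₀ + t * x (iz b)) := by
      filter_upwards [hnear] with t ht
      rw [theta_ndIdx_is L κM ht, theta_ndChart L κM ht, mul_div_assoc, div_self (hσ t ht), mul_one]
      simp
    rw [heq.deriv_eq]
    have hζ : ∀ b, HasDerivAt (fun t : ℂ => L.weierstrassZeta (z₀ + t * x (iz b))) (-℘[L] z₀ * x (iz b)) 0 := by
      intro b
      have hlin : HasDerivAt (fun t : ℂ => z₀ + t * x (iz b)) (x (iz b)) 0 := by
        simpa using ((hasDerivAt_id (0 : ℂ)).mul_const (x (iz b))).const_add z₀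
      have hζ' : HasDerivAt L.weierstrassZeta (-℘[L] z₀) (z₀ + 0 * x (iz b)) := by
        simpa using PeriodPair.hasDerivAt_weierstrassZeta hz₀
      have := hζ'.comp 0 hlin; simpa [Function.comp_def] using this
    have hsum : HasDerivAt (fun t : ℂ => ∑ b, (κM e b : ℂ) * L.weierstrassZeta (z₀ + t * x (iz b)))
        (∑ b, (κM e b : ℂ) * (-℘[L] z₀ * x (iz b))) 0 :=
      HasDerivAt.fun_sum fun b _ => (hζ b).const_mul (κM e b : ℂ)
    have h1 : HasDerivAt (fun t : ℂ => t * x (is e)) (x (is e)) 0 := by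
      simpa using (hasDerivAt_id (0 : ℂ)).mul_const (x (is e))
    have key : HasDerivAt (fun t : ℂ => t * x (is e) - ∑ b, (κM e b : ℂ) * L.weierstrassZeta (z₀ + t * x (iz b)))
        (x (is e) - ∑ b, (κM e b : ℂ) * (-℘[L] z₀ * x (iz b))) 0 := h1.sub hsum
    rw [key.deriv]
    simp only [mul_neg, neg_mul, Finset.sum_neg_distrib, sub_neg_eq_add]

omit [Fintype β] [Fintype δ] in
/-- **One point of `Lie M_κ` where `n` theta ratios have injective differential.**
[cite: NesterenkoPhilippon2001, Ch. 11 §2.2 (i)] -/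
theorem exists_nondeg_point :
    ∃ (w₀ : β ⊕ (γ ⊕ δ) → ℂ) (J₀ : Option β × ThetaIdx γ δ) (Js : (β ⊕ (γ ⊕ δ)) → Option β × ThetaIdx γ δ),
      theta L κM J₀ w₀ ≠ 0 ∧
      ∀ x : β ⊕ (γ ⊕ δ) → ℂ,
        (∀ k, deriv (fun t : ℂ => theta L κM (Js k) (w₀ + t • x) / theta L κM J₀ (w₀ + t • x)) 0 = 0) → x = 0 := by
  obtain ⟨z₀, hz₀, h℘'⟩ := L.exists_derivWeierstrassP_ne_zero
  refine ⟨ndPoint (β := β) (δ := δ) z₀, ndChart, ndIdx, ?_, fun x hx => ?_⟩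
  · rw [theta_ndChart L κM (fun b => by simpa using hz₀)]
    exact Finset.prod_ne_zero_iff.mpr fun b _ => pow_ne_zero _ (L.weierstrassSigma_ne_zero (by simpa using hz₀))
  · have hy : ∀ j, x (iy j) = 0 := fun j => by
      have := hx (Sum.inl j); rwa [deriv_ratio_ndIdx L κM hz₀ x] at this
    have hzb : ∀ b, x (iz b) = 0 := fun b => by
      have := hx (Sum.inr (Sum.inl b)); rw [deriv_ratio_ndIdx L κM hz₀ x] at this
      exact (mul_eq_zero.mp this).resolve_left h℘'
    have hs : ∀ e, x (is e) = 0 := fun e => by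
      have := hx (Sum.inr (Sum.inr e)); rw [deriv_ratio_ndIdx L κM hz₀ x] at this
      simpa [hzb] using this
    funext k
    rcases k with j | b | e
    · exact hy j
    · exact hzb b
    · exact hs e

end Std

end GaGmE

end Literature.NumberTheory.Transcendental
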